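/-
rh-split cell (screw), width seat 2 on line L23 (route-RiemannHypothesis-ScrewExcursionDoor, desk
rh-idea-9), 2026-08-27.  Pure-logic assembly of a DOOR ∧ DECLARED-RESIDUAL splitting: the residual
`ExcursionResidual` is RH-equivalent by declaration and stays OPEN — RH is not proved by this;
nothing here bears on the truth of RH.
-/
import Summits.RiemannHypothesis.RiemannHypothesis.Theses.ScrewExcursionDoor
import HarnessLib

/-!
# Route ScrewExcursionDoor (L23 «MEASURE-GRADED LANDAU DOOR») — `Assembly` (item stmt-RiemannHypothesis-22186)

`ExcursionDoor → ExcursionResidual → RiemannHypothesis` is pure logic plus the tree's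
`quasiRiemannHypothesis_one_half_iff_holds`: a zero `s` of `ζ` with `1/2 < Re s < 1` is excluded by
the door at `η = (Re s - 1/2)/2`, with the admissible `θ, σ₀ < η` supplied by the residual.  This is
the planner's kernel-checked deciding theorem `Theses.ScrewExcursionDoor.closes` (rh-idea-9 g0,
glueA.lean), restated as the route decl `Assembly`.  CONDITIONAL bookkeeping: the door
`ExcursionDoor` is PROVED (stmt-22184, `Theorems.ScrewExcursionDoorExcursionDoor.excursionDoor_proof`),
the residual `ExcursionResidual` (stmt-22185) is RH-equivalent by declaration and is nobody's proving
target — RH is not proved by this; nothing here bears on the truth of RH.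
-/

-- D-0017: `Summit.RiemannHypothesis.RiemannHypothesis.…` duplicates the namespace BY DESIGN (single-problem summit).
set_option linter.dupNamespace false

namespace Summit.RiemannHypothesis.RiemannHypothesis.Theorems.ScrewExcursionDoor

open Summit.RiemannHypothesis.RiemannHypothesis.Theses.ScrewExcursionDoor in
/-- **`Assembly` (item stmt-RiemannHypothesis-22186) holds**: for a would-be zero `s` of `ζ` in the
right half of the critical strip take `η = (Re s - 1/2)/2 > 0`, get `θ, σ₀ < η` with integrable
weighted `θ`-deficit from `ExcursionResidual`, and let `ExcursionDoor` give `QuasiRH(1/2 + η)`, which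
`s` violates; `QuasiRH(1/2) ⇒ RH` is the tree's `quasiRiemannHypothesis_one_half_iff_holds` — exactly
the route's deciding theorem `closes`.  Pure logic; RH is not proved by this (the residual stays
open). -/
theorem assembly_proof :
    Summit.RiemannHypothesis.RiemannHypothesis.Theses.ScrewExcursionDoor.Assembly := by
  intro hD hR
  exact closes hD hR

end Summit.RiemannHypothesis.RiemannHypothesis.Theorems.ScrewExcursionDoor
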